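import Summits.HodgeConjecture.HodgeConjecture.Theses.HeckePrymWeil
import Summits.HodgeConjecture.HodgeConjecture.Theorems.WeilTenfoldsSqrtMinus11.Negative.EigenvalueSeparation
import Summits.HodgeConjecture.HodgeConjecture.Theorems.WeilTwelvefoldsSqrtMinus7.Negative.WeilPlaneReality
import Literature.AlgebraicGeometry.HodgeTheory.ComplexConjugation

/-!
# `WeilTenfoldsSqrtMinus11` (stmt-HodgeConjecture-1262) · Negative · the real structure of the typed Weil plane

Negative-side / tightness knowledge for the crux `HeckePrymWeil.WeilTenfoldsSqrtMinus11`, from the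
standing disprover's work file `Cruxes/WeilTenfoldsSqrtMinus11/Disproof.lean` §G
(refuter-cdisprove-stmt-HodgeConjecture-1262-g2-0, cycle 2, 2026-08-16). It is the `p = 11`, degree-`10`
instance of the sibling file `WeilTwelvefoldsSqrtMinus7/Negative/WeilPlaneReality` (crux 1261), whose
GENERIC lemmas (`conjClass_mem_eigenspace_map`, `eq_zero_of_isRationalClass_of_mem_eigenspace`,
`components_mem_span_pair`, over the tree's complex conjugation `conjClass` on `Hᵏ(Y; ℂ)`,
`Literature/AlgebraicGeometry/HodgeTheory/ComplexConjugation`) are imported, not re-proved; the only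
arithmetic input is `weil11_plus_ne_minus : (1+i√11)¹⁰ ≠ (1-i√11)¹⁰` (`Negative/EigenvalueSeparation`).
Everything is unconditional and holds for EVERY abelian variety `A` and EVERY endomorphism `ψ`.

The crux types the Weil plane as `Eig((𝟙+φ)^*, (1+i√11)¹⁰) ⊔ Eig((𝟙+φ)^*, (1-i√11)¹⁰)` in
`H¹⁰(A(ℂ); ℂ)`; conjugation fixes rational classes and maps `Eig(g^*, μ)` to `Eig(g^*, conj μ)`, and
`conj (1+i√11)¹⁰ = (1-i√11)¹⁰ ≠ (1+i√11)¹⁰` (`conj_weilEigenvalue_ten_ne`), so it SWAPS the two typed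
eigenspaces. Hence:

* `rational_mem_plusEigenspace_eq_zero` / `…minus…` : a RATIONAL class in ONE typed eigenspace is `0`;
* `onlyPlusVariant_holds`, `onlyMinusVariant_holds` — REFUTED-AS-VACUOUS STRENGTHENINGS OF THE TYPING:
  the variants of the crux whose Weil-plane hypothesis keeps one eigenspace are provable outright (every
  admissible class is `0`): the `⊔` is essential, and a line stub typed on one eigenline proves nothing;
* `weilComponents_conj` (`conj c₊ = c₋`), `weilComponent_rational_imp_zero`, `weilComponents_ne_zero` —
  SHAPE OF ANY COUNTEREXAMPLE: a non-zero rational class of the typed plane has two non-zero,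
  non-rational, conjugate components; the crux can never be applied to a component separately;
* `weilComponents_mem_span_pair` : `c₊, c₋ ∈ span_ℂ {c, ψ^* c}` — the 2×2 inversion of
  `WeilDescending`'s recombination step at this rung.
-/

noncomputable section

open Complex CategoryTheory
open Literature.AlgebraicGeometry Literature.AlgebraicGeometry.HodgeTheory
open Literature.AlgebraicTopology.SingularHomology
open Summit.HodgeConjecture.HodgeConjecture.Theorems.WeilTwelvefoldsSqrtMinus7.Negative
  (conjClass_mem_eigenspace_map eq_zero_of_mem_eigenspace_of_mem_eigenspace
    eq_zero_of_isRationalClass_of_mem_eigenspace components_mem_span_pair)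

namespace Summit.HodgeConjecture.HodgeConjecture.Theorems.WeilTenfoldsSqrtMinus11.Negative

/-! ## The conjugate of the typed eigenvalue `(1 + i√11)¹⁰` -/

/-- `conj √11 = √11` in `ℂ`. [folklore] -/
theorem conj_sqrt11 : starRingEnd ℂ ((Real.sqrt (11 : ℝ) : ℝ) : ℂ) = ((Real.sqrt (11 : ℝ) : ℝ) : ℂ) :=
  Complex.conj_ofReal _

/-- `conj((1+i√11)^n) = (1-i√11)^n`. [folklore] -/
theorem conj_one_add_I_sqrt11_pow (n : ℕ) :
    starRingEnd ℂ ((1 + I * ((Real.sqrt (11 : ℝ) : ℝ) : ℂ)) ^ n) =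
      (1 - I * ((Real.sqrt (11 : ℝ) : ℝ) : ℂ)) ^ n := by
  rw [map_pow, map_add, map_one, map_mul, Complex.conj_I, conj_sqrt11]
  ring

/-- `conj((1-i√11)^n) = (1+i√11)^n`. [folklore] -/
theorem conj_one_sub_I_sqrt11_pow (n : ℕ) :
    starRingEnd ℂ ((1 - I * ((Real.sqrt (11 : ℝ) : ℝ) : ℂ)) ^ n) =
      (1 + I * ((Real.sqrt (11 : ℝ) : ℝ) : ℂ)) ^ n := by
  rw [map_pow, map_sub, map_one, map_mul, Complex.conj_I, conj_sqrt11]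
  ring

/-- The typed eigenvalue `(1+i√11)¹⁰` is not real: its conjugate is the OTHER typed eigenvalue.
[folklore] -/
theorem conj_weilEigenvalue_ten_ne :
    starRingEnd ℂ ((1 + I * ((Real.sqrt (11 : ℝ) : ℝ) : ℂ)) ^ 10) ≠
      (1 + I * ((Real.sqrt (11 : ℝ) : ℝ) : ℂ)) ^ 10 := by
  rw [conj_one_add_I_sqrt11_pow]
  exact weil11_plus_ne_minus.symm

/-- Mirror: `conj((1-i√11)¹⁰) ≠ (1-i√11)¹⁰`. [folklore] -/
theorem conj_weilEigenvalueBar_ten_ne :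
    starRingEnd ℂ ((1 - I * ((Real.sqrt (11 : ℝ) : ℝ) : ℂ)) ^ 10) ≠
      (1 - I * ((Real.sqrt (11 : ℝ) : ℝ) : ℂ)) ^ 10 := by
  rw [conj_one_sub_I_sqrt11_pow]
  exact weil11_plus_ne_minus

/-! ## Crux level: the typed Weil plane of `(A, ψ)` in `H¹⁰(A(ℂ); ℂ)` -/

section Crux

variable (A : Motives.AbelianVariety ℂ) (ψ : A ⟶ A)

/-- **A rational class in the `+` typed eigenspace ALONE is zero** — for every abelian variety `A`
and every endomorphism `ψ` (no dimension, no Weil relation). [cite: VoisinHodgeI2002, Cor. 6.12] -/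
theorem rational_mem_plusEigenspace_eq_zero {c : complexBetti A.X 10} (hr : IsRationalClass c)
    (hc : c ∈ Module.End.eigenspace (complexBetti.map ψ.hom.hom.hom 10).hom
      ((1 + I * ((Real.sqrt (11 : ℝ) : ℝ) : ℂ)) ^ 10)) : c = 0 :=
  eq_zero_of_isRationalClass_of_mem_eigenspace _ conj_weilEigenvalue_ten_ne hr hc

/-- Mirror: a rational class in the `-` typed eigenspace alone is zero.
[cite: VoisinHodgeI2002, Cor. 6.12] -/
theorem rational_mem_minusEigenspace_eq_zero {c : complexBetti A.X 10} (hr : IsRationalClass c)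
    (hc : c ∈ Module.End.eigenspace (complexBetti.map ψ.hom.hom.hom 10).hom
      ((1 - I * ((Real.sqrt (11 : ℝ) : ℝ) : ℂ)) ^ 10)) : c = 0 :=
  eq_zero_of_isRationalClass_of_mem_eigenspace _ conj_weilEigenvalueBar_ten_ne hr hc

/-- **Refuted-as-vacuous strengthening of the typing (`+` only).** The variant of the crux
`WeilTenfoldsSqrtMinus11` whose Weil-plane hypothesis keeps only `Eig((𝟙+φ)^*, (1+i√11)¹⁰)` holds
outright: every admissible class is `0 ∈ algebraicClasses`. The `⊔` of both eigenspaces is essential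
to the meaning of the crux; a line whose stub is typed on one eigenspace proves nothing. [folklore] -/
theorem onlyPlusVariant_holds :
    ∀ (A : Motives.AbelianVariety ℂ) (φ : A ⟶ A), A.dim = 10 →
      CategoryStruct.comp φ φ = -((11 : ℤ) • CategoryStruct.id A) →
      ∀ c : complexBetti A.X 10, IsRationalClass c → IsOfHodgeType 10 A.X 10 5 5 c →
        c ∈ Module.End.eigenspace (complexBetti.map (CategoryStruct.id A + φ).hom.hom.hom 10).hom
              ((1 + Complex.I * (Real.sqrt (11 : ℝ) : ℂ)) ^ 10) →
        c ∈ algebraicClasses A.X 5 := by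
  intro A φ _ _ c hr _ hc
  rw [rational_mem_plusEigenspace_eq_zero A _ hr hc]
  exact Submodule.zero_mem _

/-- **Refuted-as-vacuous strengthening of the typing (`-` only).** [folklore] -/
theorem onlyMinusVariant_holds :
    ∀ (A : Motives.AbelianVariety ℂ) (φ : A ⟶ A), A.dim = 10 →
      CategoryStruct.comp φ φ = -((11 : ℤ) • CategoryStruct.id A) →
      ∀ c : complexBetti A.X 10, IsRationalClass c → IsOfHodgeType 10 A.X 10 5 5 c →
        c ∈ Module.End.eigenspace (complexBetti.map (CategoryStruct.id A + φ).hom.hom.hom 10).hom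
              ((1 - Complex.I * (Real.sqrt (11 : ℝ) : ℂ)) ^ 10) →
        c ∈ algebraicClasses A.X 5 := by
  intro A φ _ _ c hr _ hc
  rw [rational_mem_minusEigenspace_eq_zero A _ hr hc]
  exact Submodule.zero_mem _

/-- **The Weil components of a rational class are conjugate**: if `c = c₊ + c₋` is rational with
`c± ∈ Eig(ψ^*, (1 ± i√11)¹⁰)` then `conj c₊ = c₋`. [cite: VoisinHodgeI2002, Cor. 6.12] -/
theorem weilComponents_conj {c cp cm : complexBetti A.X 10} (hr : IsRationalClass c)
    (hp : cp ∈ Module.End.eigenspace (complexBetti.map ψ.hom.hom.hom 10).hom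
      ((1 + I * ((Real.sqrt (11 : ℝ) : ℝ) : ℂ)) ^ 10))
    (hm : cm ∈ Module.End.eigenspace (complexBetti.map ψ.hom.hom.hom 10).hom
      ((1 - I * ((Real.sqrt (11 : ℝ) : ℝ) : ℂ)) ^ 10))
    (hc : c = cp + cm) : conjClass _ 10 cp = cm := by
  have hp' := conjClass_mem_eigenspace_map _ hp
  have hm' := conjClass_mem_eigenspace_map _ hm
  rw [conj_one_add_I_sqrt11_pow] at hp'
  rw [conj_one_sub_I_sqrt11_pow] at hm'
  have hcc : conjClass _ 10 cp + conjClass _ 10 cm = cp + cm := by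
    rw [← conjClass_add, ← hc, hr.conjClass_eq]
  have hd1 : conjClass _ 10 cp - cm ∈ Module.End.eigenspace (complexBetti.map ψ.hom.hom.hom 10).hom
      ((1 - I * ((Real.sqrt (11 : ℝ) : ℝ) : ℂ)) ^ 10) := Submodule.sub_mem _ hp' hm
  have heq : conjClass _ 10 cp - cm = cp - conjClass _ 10 cm := by
    rw [sub_eq_sub_iff_add_eq_add, hcc]
  have hd2 : conjClass _ 10 cp - cm ∈ Module.End.eigenspace (complexBetti.map ψ.hom.hom.hom 10).hom
      ((1 + I * ((Real.sqrt (11 : ℝ) : ℝ) : ℂ)) ^ 10) := by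
    rw [heq]; exact Submodule.sub_mem _ hp hm'
  exact sub_eq_zero.1
    (eq_zero_of_mem_eigenspace_of_mem_eigenspace _ weil11_plus_ne_minus hd2 hd1)

/-- **Refuted strengthening: rational components.** If the `+` component of a rational class of the
typed plane is itself rational, the class is `0`: the crux can never be applied componentwise, and a
counterexample class has two non-zero, non-rational, conjugate components. [folklore] -/
theorem weilComponent_rational_imp_zero {c cp cm : complexBetti A.X 10} (hr : IsRationalClass c)
    (hp : cp ∈ Module.End.eigenspace (complexBetti.map ψ.hom.hom.hom 10).hom
      ((1 + I * ((Real.sqrt (11 : ℝ) : ℝ) : ℂ)) ^ 10))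
    (hm : cm ∈ Module.End.eigenspace (complexBetti.map ψ.hom.hom.hom 10).hom
      ((1 - I * ((Real.sqrt (11 : ℝ) : ℝ) : ℂ)) ^ 10))
    (hc : c = cp + cm) (hpr : IsRationalClass cp) : c = 0 := by
  have h0 : cp = 0 := rational_mem_plusEigenspace_eq_zero A ψ hpr hp
  have h1 := weilComponents_conj A ψ hr hp hm hc
  rw [h0, conjClass_zero] at h1
  rw [hc, h0, ← h1, add_zero]

/-- **Both components of a non-zero rational Weil class are non-zero.** With `c = c₊ + c₋` as above and
`c ≠ 0`: `c₊ ≠ 0` and `c₋ ≠ 0` (shape constraint on any counterexample to the crux). [folklore] -/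
theorem weilComponents_ne_zero {c cp cm : complexBetti A.X 10} (hr : IsRationalClass c)
    (hp : cp ∈ Module.End.eigenspace (complexBetti.map ψ.hom.hom.hom 10).hom
      ((1 + I * ((Real.sqrt (11 : ℝ) : ℝ) : ℂ)) ^ 10))
    (hm : cm ∈ Module.End.eigenspace (complexBetti.map ψ.hom.hom.hom 10).hom
      ((1 - I * ((Real.sqrt (11 : ℝ) : ℝ) : ℂ)) ^ 10))
    (hc : c = cp + cm) (h0 : c ≠ 0) : cp ≠ 0 ∧ cm ≠ 0 := by
  have hconj := weilComponents_conj A ψ hr hp hm hc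
  constructor
  · intro hp0
    apply h0
    rw [hc, hp0, ← hconj, hp0, conjClass_zero, add_zero]
  · intro hm0
    apply h0
    have : cp = 0 := by
      have h := congrArg (conjClass _ 10) hconj
      rw [conjClass_conjClass, hm0, conjClass_zero] at h
      exact h
    rw [hc, this, hm0, add_zero]

/-- **2×2 inversion at `p = 11`**: both Weil components of `c` lie in `span_ℂ {c, ψ^* c}` (the linear
algebra of `WeilDescending`'s recombination step at this rung, `λ = (1+i√11)¹⁰ ≠ λ̄`). [folklore] -/
theorem weilComponents_mem_span_pair {c cp cm : complexBetti A.X 10}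
    (hp : cp ∈ Module.End.eigenspace (complexBetti.map ψ.hom.hom.hom 10).hom
      ((1 + I * ((Real.sqrt (11 : ℝ) : ℝ) : ℂ)) ^ 10))
    (hm : cm ∈ Module.End.eigenspace (complexBetti.map ψ.hom.hom.hom 10).hom
      ((1 - I * ((Real.sqrt (11 : ℝ) : ℝ) : ℂ)) ^ 10))
    (hc : c = cp + cm) :
    cp ∈ Submodule.span ℂ {c, (complexBetti.map ψ.hom.hom.hom 10).hom c} ∧
      cm ∈ Submodule.span ℂ {c, (complexBetti.map ψ.hom.hom.hom 10).hom c} :=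
  components_mem_span_pair _ weil11_plus_ne_minus hp hm hc

end Crux

end Summit.HodgeConjecture.HodgeConjecture.Theorems.WeilTenfoldsSqrtMinus11.Negative

end
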